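import Summits.BirchSwinnertonDyer.BirchSwinnertonDyer.Theorems.QuadraticBranchSignedControlEtaLayerSignedPoints
import Literature.NumberTheory.EllipticCurves.SubgroupSelmerProofs
import HarnessLib

/-!
# Base change of local Selmer conditions along `subgroupH1Iso`, file 3: Kobayashi's KUMMER LOCAL
# CONDITION corresponds (cocycle level, both directions); change of embedding
(cell `bsd-potss`, seat `bsd-potss-k8q-c3` g2; rung K8, route `QuadraticBranchSignedControl`, crux
`EtaTransportSigned` (stmt-BirchSwinnertonDyer-19115), child `EtaLayerComparison`
(stmt-BirchSwinnertonDyer-19583))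

WHAT. In the two-way local package of files 1–2 (`K ⊆ L`, `ι₂ : Ē ≃ Ē'` compatible with
`ι : K̄ → Ē`, `ι' : L̄ → Ē'`, `f : E → E'`, fixing hypothesis for `U ≤ galRange L`; transports
`θ = ι₂(·)ι₂⁻¹` on local Galois groups, `ψ = (ι₂⁻¹)_*` on local points):
* §1 **`subgroupH1Iso_mem_localKummerOverOfEmb_iff`** — for ANY subgroup `A'` of `E_L(Ē')`, a class
  `x ∈ H¹(U^L, E_L[p^∞])` satisfies Kobayashi's Kummer condition at `ι'` cut out by `A'`
  («`x = [c]`, `ι'_*(c(τ|)) = τQ − Q` on `(U^L)_{ι'}`, `pᵏQ ∈ A'`», `Kobayashi2003.localKummerOverOfEmb`)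
  IFF ctrl's `subgroupH1Iso x ∈ H¹(U, E[p^∞])` satisfies it at `ι` cut out by `ψ(A')`: the class of
  `c` maps to the class of the pulled-back cocycle (`map_oneCocycleClass`), whose values on `U_ι`
  are read through the group identity `res_{ι'} ∘ θ = subgroupToComap ∘ res_ι` and the coefficient
  identity `ψ ∘ ι'_* ∘ (E[p^∞] ≃ E_L[p^∞]) = ι_*` (T-res file C); the witness point is `ψ Q`
  (resp. `ψ⁻¹ Q` backwards, with `θ⁻¹` from file 1);
* §2 change of embedding: `comap (conj_τ) (localKummer_{ι₀} A) = localKummer_{ι₀ ∘ τ} A`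
  (conjugated cocycle `conjCocycle`, `(ι₀ ∘ τ)_* = ι₀_* ∘ τ`), and the signed local points of
  Def. 1.1 / §2 p. 4 do not depend on the embedding (normal layer subgroups).

HONEST FRAMING (cell `bsd-potss`, run/shared/lean/pub/bsd-potss/; FULL-BSD rank ≤ 1 programme):
INFRASTRUCTURE THEOREMS ONLY — no definition, no named Literature fact, no `sorry`, axioms
standard; nothing about (C1_η), Kobayashi's theorems or `BSD(W, p)` is claimed; no label or count
moves. Helper toward item 19583.

References: [Kobayashi2003] Def. 1.1 (p. 2), §2 p. 4 («we regard `E(K_{n,v}) ⊗ ℚ_p/ℤ_p` as a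
subgroup of `H¹(K_{n,v}, E[p^∞])` by the Kummer map»); [SerreGaloisCohomology1997] I.§2.4–2.5,
II.§1.1; [GreenbergLNM1716] §2.
-/

set_option autoImplicit false
set_option linter.dupNamespace false

noncomputable section

open scoped Classical

open Literature.NumberTheory.EllipticCurves
open Literature.NumberTheory.GaloisRepresentations
open Summit.BirchSwinnertonDyer.Rank1Residual.Additive
open Summit.BirchSwinnertonDyer.Rank1Residual.Additive.LocalTransport
open Summit.BirchSwinnertonDyer.Rank1Residual.Additive.BaseChange

universe u

namespace Summit.BirchSwinnertonDyer.BirchSwinnertonDyer.Theorems.EtaLayer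

/-! ## §0 The map of a compatible pair on explicit cocycles -/

section Cocycle

variable {G : Type u} [Group G] [TopologicalSpace G] [IsTopologicalGroup G]
variable {M : Type u} [AddCommGroup M] [DistribMulAction G M] [TopologicalSpace M] [DiscreteTopology M]
variable {G' : Type u} [Group G'] [TopologicalSpace G'] [IsTopologicalGroup G']
variable {N : Type u} [AddCommGroup N] [DistribMulAction G' N] [TopologicalSpace N] [DiscreteTopology N]

/-- `resH1Hom φ ψ` on explicit cocycles: `[c] ↦ [ψ ∘ c ∘ φ]` (the tree's `map_oneCocycleClass`).
[cite: SerreGaloisCohomology1997, I.§2.4] -/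
theorem resH1Hom_oneCocycleClass (φ : G' →ₜ* G) (ψ : M →+ N)
    (h : ∀ (x : G') (m : M), ψ (φ x • m) = x • ψ m) (c : contOneCocycles (discreteTopRep G M)) :
    resH1Hom φ ψ h (oneCocycleClass (discreteTopRep G M) c) =
      oneCocycleClass (discreteTopRep G' N)
        (contOneCocycles.pullback φ (resHomOfEquivariant φ ψ h) c) :=
  map_oneCocycleClass (X := discreteTopRep G M) (Y := discreteTopRep G' N) φ
    (resHomOfEquivariant φ ψ h) c

omit [IsTopologicalGroup G] [IsTopologicalGroup G'] in
/-- Values of the pulled-back cocycle: `(ψ ∘ c ∘ φ)(x) = ψ (c (φ x))`. [folklore] -/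
theorem pullback_resHomOfEquivariant_apply (φ : G' →ₜ* G) (ψ : M →+ N)
    (h : ∀ (x : G') (m : M), ψ (φ x • m) = x • ψ m) (c : contOneCocycles (discreteTopRep G M))
    (x : G') :
    (contOneCocycles.pullback φ (resHomOfEquivariant φ ψ h) c).1 x = ψ (c.1 (φ x)) :=
  rfl

end Cocycle

variable {K : Type u} [Field K] (L : Type u) [Field L] [Algebra K L] [Algebra.IsAlgebraic K L]
  [PerfectField L]
variable {E : Type u} [Field E] [Algebra K E] {E' : Type u} [Field E'] [Algebra L E']
  [Algebra K E'] [IsScalarTower K L E']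
variable (ι : AlgebraicClosure K →ₐ[K] AlgebraicClosure E)
  (ι₂ : AlgebraicClosure E ≃+* AlgebraicClosure E')
  (ι' : AlgebraicClosure L →ₐ[L] AlgebraicClosure E')
  (hcompat : ∀ z : AlgebraicClosure K, ι' (closureEmb (K := K) L z) = ι₂ (ι z))
  (f : E →+* E')
  (hf : ∀ y : E, ι₂ (algebraMap E (AlgebraicClosure E) y) = algebraMap E' (AlgebraicClosure E') (f y))
  (W : WeierstrassCurve K) (p : ℕ)

/-! ## §1 The Kummer condition under `subgroupH1Iso` -/

section Kummer

variable {U : Subgroup (Field.absoluteGaloisGroup K)} (hU : U ≤ galRange (K := K) L)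
  (hfixL : ∀ h : Field.absoluteGaloisGroup E, resGalOfEmb ι h ∈ galRange (K := K) L → ∀ y : E',
    (show AlgebraicClosure E ≃ₐ[E] AlgebraicClosure E from h)
      (ι₂.symm (algebraMap E' (AlgebraicClosure E') y)) =
        ι₂.symm (algebraMap E' (AlgebraicClosure E') y))

omit [Algebra K E'] [IsScalarTower K L E'] in
/-- The group identity of the package, pointwise: `subgroupToComap (res_ι t) = res_{ι'} (θ t)` in
`U^L` for `t ∈ U_ι`. [cite: SerreGaloisCohomology1997, II.§1.1] -/
theorem subgroupToComap_resGalSubgroupOfEmb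
    (hfix : ∀ h : Field.absoluteGaloisGroup E, resGalOfEmb ι h ∈ U → ∀ y : E',
      (show AlgebraicClosure E ≃ₐ[E] AlgebraicClosure E from h)
        (ι₂.symm (algebraMap E' (AlgebraicClosure E') y)) =
          ι₂.symm (algebraMap E' (AlgebraicClosure E') y))
    (t : localSubgroupOfEmb U ι) :
    subgroupToComap L hU (resGalSubgroupOfEmb U ι t) =
      resGalSubgroupOfEmb (comapResGal L U) ι'
        (transportHom L U (comapResGal L U) (fun _ h => h) ι ι₂ ι' hcompat hfix t) := by
  have h := DFunLike.congr_fun (resGalSubgroupOfEmb_comp_transportHom L U (comapResGal L U)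
    (fun _ h => h) ι ι₂ ι' hcompat hfix (subgroupToComap L hU) (resGal_subgroupToComap L hU)) t
  exact h.symm

omit [PerfectField L] [Algebra K E'] [IsScalarTower K L E'] in
include hcompat hf in
/-- The same for the inverse transport: `comapToSubgroup (res_{ι'} t') = res_ι (ι₂⁻¹ t' ι₂)` in `U`.
[cite: SerreGaloisCohomology1997, II.§1.1] -/
theorem comapToSubgroup_resGalSubgroupOfEmb (t' : localSubgroupOfEmb (comapResGal L U) ι') :
    comapToSubgroup L U (resGalSubgroupOfEmb (comapResGal L U) ι' t') =
      resGalSubgroupOfEmb U ι ⟨transportAut ι₂.symm (t' : Field.absoluteGaloisGroup E')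
          (fix_symm ι₂ f hf t'),
        transportAut_symm_mem_localSubgroupOfEmb L ι ι₂ ι' hcompat f hf U (comapResGal L U)
          (fun _ h => h) t' t'.2⟩ := by
  apply Subtype.ext
  rw [coe_comapToSubgroup, resGalSubgroupOfEmb_apply_coe, resGalSubgroupOfEmb_apply_coe,
    resGalOfEmb_transportAut_symm L ι ι₂ ι' hcompat]

omit [PerfectField L] in
/-- The coefficient identity of the package, solved for `ι_*`:
`ι_* ((E[p^∞] ≃ E_L[p^∞])⁻¹ Z) = ψ (ι'_* Z)` for `Z ∈ E_L[p^∞]`. [cite: SerreGaloisCohomology1997, II.§1.1] -/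
theorem pointsMapOfEmb_primaryBaseChangeEquiv_symm (Z : (W.baseChange L).geomPrimaryTorsion p) :
    pointsMapOfEmb W ι (((primaryBaseChangeEquiv L W p).symm Z : W.geomPrimaryTorsion p) :
        WeierstrassCurve.geomPoints W) =
      transportPoints L ι ι₂ ι' hcompat W
        (pointsMapOfEmb (W.baseChange L) ι' (Z : WeierstrassCurve.geomPoints (W.baseChange L))) := by
  rw [← transportPoints_pointsMapOfEmb L ι ι₂ ι' hcompat W p ((primaryBaseChangeEquiv L W p).symm Z),
    AddEquiv.apply_symm_apply]

include hcompat f hf hfixL in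
/-- **Kobayashi's Kummer local condition corresponds under `subgroupH1Iso`, for ANY cutting
subgroup.** For `U ≤ galRange L`, `A' ≤ E_L(Ē')` and `x ∈ H¹(U^L, E_L[p^∞])`:
`subgroupH1Iso x ∈ localKummerOverOfEmb_W U ι (ψ A') ↔ x ∈ localKummerOverOfEmb_{W_L} U^L ι' A'`.
`←`: `x = [c]` with witness `(Q, k)` on `(U^L)_{ι'}`; `subgroupH1Iso x = [c ∘ subgroupToComap]`
(coefficients through `(E[p^∞] ≃ E_L[p^∞])⁻¹`) and on `t ∈ U_ι`:
`ι_*(c(subgroupToComap (t|))) = ψ(ι'_*(c((θt)|))) = ψ(θt•Q − Q) = t•ψQ − ψQ`. `→`: symmetrically with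
`subgroupH1Iso⁻¹ = [· ∘ comapToSubgroup]`, `θ⁻¹ = ι₂⁻¹(·)ι₂`, and `ψ` bijective (witness `ψ⁻¹ Q`).
In the crux: Kobayashi's plus condition at `𝔭 ∣ p` for `V_F` over `F_n` IS the tower plus condition
for `V` over `Fℚ_n` under ctrl's base-change isomorphism.
[cite: Kobayashi2003, Def. 1.1 (p. 2), §2 p. 4, Def. 2.1 (p. 5)] [cite: SerreGaloisCohomology1997, I.§2.4, II.§1.1] -/
theorem subgroupH1Iso_mem_localKummerOverOfEmb_iff (A' : AddSubgroup (localPoints (W.baseChange L) E'))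
    (x : (W.baseChange L).subgroupH1 p (comapResGal L U)) :
    subgroupH1Iso L W p hU x ∈ Kobayashi2003.localKummerOverOfEmb W p U ι
        (A'.map (transportPoints L ι ι₂ ι' hcompat W)) ↔
      x ∈ Kobayashi2003.localKummerOverOfEmb (W.baseChange L) p (comapResGal L U) ι' A' := by
  have hfix : ∀ h : Field.absoluteGaloisGroup E, resGalOfEmb ι h ∈ U → ∀ y : E',
      (show AlgebraicClosure E ≃ₐ[E] AlgebraicClosure E from h)
          (ι₂.symm (algebraMap E' (AlgebraicClosure E') y)) =
        ι₂.symm (algebraMap E' (AlgebraicClosure E') y) := fun g hg => hfixL g (hU hg)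
  set ψ := transportPoints L ι ι₂ ι' hcompat W with hψdef
  have hψinj : Function.Injective ψ := (transportPoints_bijective L ι ι₂ ι' hcompat W).1
  set θ := transportHom L U (comapResGal L U) (fun _ h => h) ι ι₂ ι' hcompat hfix with hθdef
  have hθs : ∀ (t : localSubgroupOfEmb U ι) (R : localPoints (W.baseChange L) E'),
      ψ (((θ t : localSubgroupOfEmb (comapResGal L U) ι') : Field.absoluteGaloisGroup E') • R) =
        (t : Field.absoluteGaloisGroup E) • ψ R := by
    intro t R
    have key := transportPoints_smul L U (comapResGal L U) (fun _ h => h) ι ι₂ ι' hcompat hfix W t R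
    rw [Subgroup.smul_def, Subgroup.smul_def] at key
    exact key
  constructor
  · -- `→`: pull the witness back along `subgroupH1Iso⁻¹`, `θ⁻¹`, `ψ⁻¹`
    rintro ⟨c₁, P₁, k, hc₁, hA₁, hloc₁⟩
    obtain ⟨Q, rfl⟩ := (transportPoints_bijective L ι ι₂ ι' hcompat W).2 P₁
    have hA' : p ^ k • Q ∈ A' := by
      obtain ⟨a, ha, hψa⟩ := AddSubgroup.mem_map.mp hA₁
      rw [← map_nsmul] at hψa
      rwa [← hψinj hψa]
    refine ⟨contOneCocycles.pullback (comapToSubgroup L U)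
        (resHomOfEquivariant (comapToSubgroup L U) (primaryBaseChangeEquiv L W p).toAddMonoidHom
          (primaryBaseChangeEquiv_comapToSubgroup_smul L W p)) c₁, Q, k, ?_, hA', fun t' => ?_⟩
    · rw [← resH1Hom_oneCocycleClass]
      change (subgroupH1Iso L W p hU).symm (oneCocycleClass _ c₁) = x
      rw [hc₁, AddEquiv.symm_apply_apply]
    · -- the local element `θ⁻¹ t' ∈ U_ι`; `ψ (t' • Q) = θ⁻¹ t' • ψ Q`
      have hh : transportAut ι₂.symm (t' : Field.absoluteGaloisGroup E') (fix_symm ι₂ f hf t') ∈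
          localSubgroupOfEmb U ι :=
        transportAut_symm_mem_localSubgroupOfEmb L ι ι₂ ι' hcompat f hf U (comapResGal L U)
          (fun _ h => h) t' t'.2
      have hsmul : ψ ((t' : Field.absoluteGaloisGroup E') • Q) =
          transportAut ι₂.symm (t' : Field.absoluteGaloisGroup E') (fix_symm ι₂ f hf t') • ψ Q := by
        have key := transportPoints_transportAut_smul L ι ι₂ ι' hcompat hfixL W U (comapResGal L U)
          hU (fun _ h => h) _ hh Q
        rw [transportAut_transportAut_symm] at key
        exact key
      rw [pullback_resHomOfEquivariant_apply,
        comapToSubgroup_resGalSubgroupOfEmb L ι ι₂ ι' hcompat f hf (U := U) t', AddEquiv.coe_toAddMonoidHom]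
      apply hψinj
      rw [map_sub, hsmul, transportPoints_pointsMapOfEmb L ι ι₂ ι' hcompat W p]
      exact hloc₁ ⟨_, hh⟩
  · -- `←`: push the witness forward along `subgroupH1Iso`, `θ`, `ψ`
    rintro ⟨c, Q, k, rfl, hA, hloc⟩
    refine ⟨contOneCocycles.pullback (subgroupToComap L hU)
        (resHomOfEquivariant (subgroupToComap L hU) (primaryBaseChangeEquiv L W p).symm.toAddMonoidHom
          (primaryBaseChangeEquiv_symm_subgroupToComap_smul L W p hU)) c,
      ψ Q, k, ?_, ?_, fun t => ?_⟩
    · rw [← resH1Hom_oneCocycleClass]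
      rfl
    · rw [← map_nsmul]
      exact AddSubgroup.mem_map_of_mem ψ hA
    · rw [pullback_resHomOfEquivariant_apply,
        subgroupToComap_resGalSubgroupOfEmb L ι ι₂ ι' hcompat hU hfix t, AddEquiv.coe_toAddMonoidHom,
        pointsMapOfEmb_primaryBaseChangeEquiv_symm L ι ι₂ ι' hcompat W p, hloc (θ t), map_sub, hθs]

end Kummer

/-! ## §2 Change of embedding -/

section EmbChange

omit [Algebra.IsAlgebraic K L] [PerfectField L]

variable {ι₀ : AlgebraicClosure K →ₐ[K] AlgebraicClosure E} (H : Subgroup (Field.absoluteGaloisGroup K))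

/-- **The Kummer condition at a conjugate embedding**: for `H` normal, `τ ∈ Γ_K` and a cutting subgroup
`A ≤ E(Ē)`, `conj_τ c` satisfies Kobayashi's Kummer condition at `ι₀` IFF `c` satisfies it at `ι₀ ∘ τ`
(conjugated cocycle `(τ⁻¹·φ)` / `(τ·φ)`, `(ι₀∘τ)_* = ι₀_* ∘ τ`, `res_{ι₀∘τ} t = τ⁻¹ (res_{ι₀} t) τ`) — the
local condition at another place of `L = K̄^H` above the same place of `K` (cf. the tree's
`localKerOverOfEmb_comp` for the classical condition).
[cite: Kobayashi2003, Def. 1.1 (p. 2), §2 p. 4] [cite: GreenbergLNM1716, §2] -/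
theorem comap_conjH1_localKummerOverOfEmb [H.Normal] (ι₀ : AlgebraicClosure K →ₐ[K] AlgebraicClosure E)
    (τ : AlgebraicClosure K ≃ₐ[K] AlgebraicClosure K) (A : AddSubgroup (localPoints W E)) :
    (Kobayashi2003.localKummerOverOfEmb W p H ι₀ A).comap
        (W.conjH1 p H (show Field.absoluteGaloisGroup K from τ)) =
      Kobayashi2003.localKummerOverOfEmb W p H
        (ι₀.comp (τ : AlgebraicClosure K →ₐ[K] AlgebraicClosure K)) A := by
  -- local elements: `t ∈ H_{ι₀∘τ} ↔ t ∈ H_{ι₀}`, `res_{ι₀∘τ} t = τ⁻¹ (res_{ι₀} t) τ`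
  have hsub := localSubgroupOfEmb_comp H ι₀ τ
  have hres : ∀ t : Field.absoluteGaloisGroup E,
      resGalOfEmb (ι₀.comp (τ : AlgebraicClosure K →ₐ[K] AlgebraicClosure K)) t =
        (show Field.absoluteGaloisGroup K from τ)⁻¹ * resGalOfEmb ι₀ t *
          (show Field.absoluteGaloisGroup K from τ) := fun t => resGalOfEmb_comp_apply ι₀ τ t
  have hpts : ∀ P : WeierstrassCurve.geomPoints W,
      pointsMapOfEmb W (ι₀.comp (τ : AlgebraicClosure K →ₐ[K] AlgebraicClosure K)) P =
        pointsMapOfEmb W ι₀ ((show Field.absoluteGaloisGroup K from τ) • P) := fun P =>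
    DFunLike.congr_fun (pointsMapOfEmb_comp W ι₀ τ) P
  ext c
  rw [AddSubgroup.mem_comap]
  constructor
  · rintro ⟨φ, Q, k, hφ, hA, hloc⟩
    refine ⟨conjCocycle H (show Field.absoluteGaloisGroup K from τ)⁻¹ φ, Q, k, ?_, hA, fun t => ?_⟩
    · rw [← conjH1_oneCocycleClass, hφ, ← AddMonoidHom.comp_apply, ← W.conjH1_mul_holds p H,
        inv_mul_cancel, W.conjH1_one_holds p H, AddMonoidHom.id_apply]
    · have ht₀ : (t : Field.absoluteGaloisGroup E) ∈ localSubgroupOfEmb H ι₀ := hsub ▸ t.2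
      have hconj : subgroupConj H (show Field.absoluteGaloisGroup K from τ)⁻¹
          (resGalSubgroupOfEmb H (ι₀.comp (τ : AlgebraicClosure K →ₐ[K] AlgebraicClosure K)) t) =
          resGalSubgroupOfEmb H ι₀ ⟨t, ht₀⟩ := by
        apply Subtype.ext
        rw [subgroupConj_apply_coe, resGalSubgroupOfEmb_apply_coe, resGalSubgroupOfEmb_apply_coe,
          hres, inv_inv]
        group
      rw [conjCocycle_apply, hconj, primaryComponent.coe_smul, hpts, smul_inv_smul]
      exact hloc ⟨t, ht₀⟩
  · rintro ⟨φ, Q, k, hφ, hA, hloc⟩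
    refine ⟨conjCocycle H (show Field.absoluteGaloisGroup K from τ) φ, Q, k, ?_, hA, fun t => ?_⟩
    · rw [← conjH1_oneCocycleClass, hφ]
    · have ht₁ : (t : Field.absoluteGaloisGroup E) ∈
          localSubgroupOfEmb H (ι₀.comp (τ : AlgebraicClosure K →ₐ[K] AlgebraicClosure K)) :=
        hsub.symm ▸ t.2
      have hconj : subgroupConj H (show Field.absoluteGaloisGroup K from τ)
          (resGalSubgroupOfEmb H ι₀ t) =
          resGalSubgroupOfEmb H (ι₀.comp (τ : AlgebraicClosure K →ₐ[K] AlgebraicClosure K))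
            ⟨t, ht₁⟩ := by
        apply Subtype.ext
        rw [subgroupConj_apply_coe, resGalSubgroupOfEmb_apply_coe, resGalSubgroupOfEmb_apply_coe, hres]
      rw [conjCocycle_apply, hconj, primaryComponent.coe_smul, ← hpts]
      exact hloc ⟨t, ht₁⟩

variable {W p} in
/-- Membership form: `conj_τ c ∈ localKummer_{ι₀} A ↔ c ∈ localKummer_{ι₀∘τ} A`. [cite: GreenbergLNM1716, §2] -/
theorem conjH1_mem_localKummerOverOfEmb_iff [H.Normal] (ι₀ : AlgebraicClosure K →ₐ[K] AlgebraicClosure E)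
    (τ : AlgebraicClosure K ≃ₐ[K] AlgebraicClosure K) (A : AddSubgroup (localPoints W E))
    (c : W.subgroupH1 p H) :
    W.conjH1 p H (show Field.absoluteGaloisGroup K from τ) c ∈
        Kobayashi2003.localKummerOverOfEmb W p H ι₀ A ↔
      c ∈ Kobayashi2003.localKummerOverOfEmb W p H
        (ι₀.comp (τ : AlgebraicClosure K →ₐ[K] AlgebraicClosure K)) A := by
  rw [← AddSubgroup.mem_comap, comap_conjH1_localKummerOverOfEmb]

variable {W} in
/-- **Fixed points do not depend on the embedding** (normal `H`: `H_{ι₀∘τ} = H_{ι₀}`).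
[cite: Kobayashi2003, §2 p. 4] [cite: SerreGaloisCohomology1997, II.§1.1] -/
theorem localFixedPointsOfEmb_comp [H.Normal] (ι₀ : AlgebraicClosure K →ₐ[K] AlgebraicClosure E)
    (τ : AlgebraicClosure K ≃ₐ[K] AlgebraicClosure K) :
    localFixedPointsOfEmb (ι₀.comp (τ : AlgebraicClosure K →ₐ[K] AlgebraicClosure K)) W H =
      localFixedPointsOfEmb ι₀ W H := by
  ext P
  rw [mem_localFixedPointsOfEmb_iff, mem_localFixedPointsOfEmb_iff, localSubgroupOfEmb_comp]

variable {W} in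
/-- **Traces do not depend on the embedding** (normal `H₁`, `H₂`): the sums over the coset spaces of
the equal local subgroups coincide. [cite: Kobayashi2003, §2 p. 4] -/
theorem localPairTraceOfEmb_comp (H₁ H₂ : Subgroup (Field.absoluteGaloisGroup K)) [H₁.Normal]
    [H₂.Normal] [H₂.FiniteIndex] (ι₀ : AlgebraicClosure K →ₐ[K] AlgebraicClosure E)
    (τ : AlgebraicClosure K ≃ₐ[K] AlgebraicClosure K) (P : localPoints W E) :
    localPairTraceOfEmb (ι₀.comp (τ : AlgebraicClosure K →ₐ[K] AlgebraicClosure K)) W H₁ H₂ P =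
      localPairTraceOfEmb ι₀ W H₁ H₂ P := by
  have key : ∀ (A A' B B' : Subgroup (Field.absoluteGaloisGroup E)) (_ : A = A') (_ : B = B')
      [Fintype (A ⧸ B.subgroupOf A)] [Fintype (A' ⧸ B'.subgroupOf A')],
      ∑ q : A ⧸ B.subgroupOf A, ((q.out : A) : Field.absoluteGaloisGroup E) • P =
        ∑ q : A' ⧸ B'.subgroupOf A', ((q.out : A') : Field.absoluteGaloisGroup E) • P := by
    intro A A' B B' hA hB _ _
    subst hA hB
    exact Finset.sum_congr (by convert rfl) fun _ _ => rfl
  haveI i₁ : Fintype (localSubgroupOfEmb H₁ (ι₀.comp (τ : AlgebraicClosure K →ₐ[K] AlgebraicClosure K)) ⧸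
      (localSubgroupOfEmb H₂ (ι₀.comp (τ : AlgebraicClosure K →ₐ[K] AlgebraicClosure K))).subgroupOf
        (localSubgroupOfEmb H₁ (ι₀.comp (τ : AlgebraicClosure K →ₐ[K] AlgebraicClosure K)))) :=
    Fintype.ofFinite _
  haveI i₂ : Fintype (localSubgroupOfEmb H₁ ι₀ ⧸
      (localSubgroupOfEmb H₂ ι₀).subgroupOf (localSubgroupOfEmb H₁ ι₀)) := Fintype.ofFinite _
  rw [localPairTraceOfEmb_apply, localPairTraceOfEmb_apply]
  exact key _ _ _ _ (localSubgroupOfEmb_comp H₁ ι₀ τ) (localSubgroupOfEmb_comp H₂ ι₀ τ)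

variable {W} in
/-- **cc-typer-6's signed local points `E^ε(K_{n,v})` over a tower of NORMAL subgroups do not depend
on the embedding.** [cite: Kobayashi2003, §2 p. 4] -/
theorem towerSignedLocalPointsOfEmb_comp (U : ℕ → Subgroup (Field.absoluteGaloisGroup K))
    [∀ m, (U m).Normal] [∀ m, (U m).FiniteIndex] (ι₀ : AlgebraicClosure K →ₐ[K] AlgebraicClosure E)
    (τ : AlgebraicClosure K ≃ₐ[K] AlgebraicClosure K) (ε : ℤˣ) (n : ℕ) :
    towerSignedLocalPointsOfEmb U (ι₀.comp (τ : AlgebraicClosure K →ₐ[K] AlgebraicClosure K)) W ε n =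
      towerSignedLocalPointsOfEmb U ι₀ W ε n := by
  ext P
  simp only [mem_towerSignedLocalPointsOfEmb_iff, localFixedPointsOfEmb_comp, localPairTraceOfEmb_comp]

variable {W} in
/-- **Kobayashi's signed local points `E^ε(K_n·E)` (Def. 1.1) do not depend on the embedding** (the
layer subgroups of a `ℤ_p`-extension are normal). [cite: Kobayashi2003, Def. 1.1 (p. 2)] -/
theorem signedLocalPointsOfEmb_comp {p : ℕ} [Fact p.Prime] (κ : ZpExtension K p)
    (ι₀ : AlgebraicClosure K →ₐ[K] AlgebraicClosure E) (τ : AlgebraicClosure K ≃ₐ[K] AlgebraicClosure K)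
    (ε : ℤˣ) (n : ℕ) :
    Kobayashi2003.signedLocalPointsOfEmb κ (ι₀.comp (τ : AlgebraicClosure K →ₐ[K] AlgebraicClosure K))
        W ε n = Kobayashi2003.signedLocalPointsOfEmb κ ι₀ W ε n := by
  ext P
  simp only [Kobayashi2003.mem_signedLocalPointsOfEmb_iff, localLayerPointsOfEmb_eq,
    localTraceOfEmb_eq_localPairTraceOfEmb, localFixedPointsOfEmb_comp, localPairTraceOfEmb_comp]

end EmbChange

end Summit.BirchSwinnertonDyer.BirchSwinnertonDyer.Theorems.EtaLayer

end
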